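import Summits.ResolutionOfSingularities.ResolutionOfSingularities.Theorems.WildQuotientsSummitReductionStubPairOrbitNormalFormBlowupModelCharts6
import HarnessLib

/-!
# `WildQuotients.SummitReduction` (stmt-ResolutionOfSingularities-16324), line `FramePerfect`, stub NB1
# (`stub_pair_orbitNormalFormBlowup_modelSingularOverCentre`): the model `A⟦u, v⟧/(uv - ∏ tᵢ)`
# plugged into the coefficient-free chart computation

Route `ResolutionOfSingularities/WildQuotients`, crux `SummitReduction`; seventh helper file of
stub NB1 = de Jong 1996, Claim 4.27 [C1] on the coefficient-free model `A⟦u, v⟧/(uv - ∏_{i<s} tᵢ)`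
(`DeJong1996.NodeDeformationRing`; de Jong 1997, proof of Prop. 5.11: `A` any regular local ring
with regular system of parameters `t`). The chart theorems of `…ModelCharts3.lean`
(`isRegularLocalRing_chartU`) and `…ModelCharts6.lean` (`exists_prime_le_chartT`) are
specialised to `R = A⟦u, v⟧` (a regular local ring, `isRegularLocalRing_mvPowerSeries_of_isRegularLocalRing`)
with the regular system of parameters `z = (u, v, t₀, …, t_{m-1})` (`isRsopPart_model`), the
centre `(u, v, t_a, t_b)` (index vector `(castAdd 0, castAdd 1, natAdd a, natAdd b)`), the further
branches `{natAdd i : i < s, i ≠ a, b}` and the relation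
`uv - ∏_{i<s} tᵢ = z_u z_v - t_a t_b ∏''` (`nodeDeformationRelation_eq_model`). PROVED:

* `span_range_modelRsop`, `ringKrullDim_model`, `isRsopPart_model` — `(u, v, t)` is a regular
  system of parameters of `A⟦u, v⟧` (Matsumura 15.4);
* `map_mk_span_model_eq` — `(u, v, t_a, t_b) A⟦u,v⟧` maps onto `𝔭_{ab} = (t_a, t_b) + (u, v)`;
* **`model_isRegularLocalRing_chartUV`** — the charts `u ≠ 0`, `v ≠ 0` of the blow-up of the
  model in `𝔭_{ab}` are regular over the centre ("Clearly, this is smooth");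
* **`model_exists_prime_le_chartT`** — on the chart `t_a ≠ 0` a non-regular prime `𝔮 ∋ t̄_a`
  lies over a prime `𝔯 ∌ t̄_a` containing `𝔭_{ii'}` for some `i < i' < s` (the strict transform
  of `V(𝔭_{ii'})`).

## Sources

* A. J. de Jong, *Smoothness, semi-stability and alterations*, Publ. Math. IHÉS 83 (1996), 4.27,
  pp. 75–76. [DeJong1996]
* A. J. de Jong, *Families of curves and alterations*, Ann. Inst. Fourier 47 (1997), proof of
  Prop. 5.11, p. 619. [DeJong1997]
* H. Matsumura, *Commutative Ring Theory* (1986), Thm. 15.4. [Matsumura1987]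
-/

set_option linter.dupNamespace false -- the tree's summit namespace repeats `ResolutionOfSingularities`

noncomputable section

open IsLocalRing

namespace Summit.ResolutionOfSingularities.ResolutionOfSingularities.Theorems

open Literature.AlgebraicGeometry.Resolution
open Literature.NumberTheory.GaloisRepresentations.NearlyOrdinaryPresentationCA

/-! ## Generalities -/

/-- The range of `Fin.append`. [folklore] -/
theorem Set.range_fin_append {α : Type} {m n : ℕ} (u : Fin m → α) (v : Fin n → α) :
    Set.range (Fin.append u v) = Set.range u ∪ Set.range v := by
  -- adapted from `IsRsopPart.exists_rsop` (RsopMonomialIdeals.lean)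
  ext a
  constructor
  · rintro ⟨i, rfl⟩
    induction i using Fin.addCases with
    | left j => exact Or.inl ⟨j, by simp⟩
    | right k => exact Or.inr ⟨k, by simp⟩
  · rintro (⟨j, rfl⟩ | ⟨k, rfl⟩)
    · exact ⟨Fin.castAdd n j, by simp⟩
    · exact ⟨Fin.natAdd m k, by simp⟩

/-- The range of a vector of length four. [folklore] -/
theorem Set.range_vec4 {α β : Type} (f : α → β) (a b c d : α) :
    Set.range (f ∘ ![a, b, c, d]) = {f a, f b, f c, f d} := by
  ext x
  simp only [Set.mem_range, Function.comp_apply, Set.mem_insert_iff, Set.mem_singleton_iff]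
  constructor
  · rintro ⟨i, rfl⟩
    fin_cases i
    · exact Or.inl rfl
    · exact Or.inr (Or.inl rfl)
    · exact Or.inr (Or.inr (Or.inl rfl))
    · exact Or.inr (Or.inr (Or.inr rfl))
  · rintro (rfl | rfl | rfl | rfl)
    exacts [⟨0, rfl⟩, ⟨1, rfl⟩, ⟨2, rfl⟩, ⟨3, rfl⟩]

/-- The range of a vector of length four. [folklore] -/
theorem Set.range_vec4' {α : Type} (a b c d : α) : Set.range ![a, b, c, d] = {a, b, c, d} := by
  have h := Set.range_vec4 id a b c d
  rwa [Function.id_comp] at h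

/-- Injectivity of a vector of length four with pairwise distinct entries. [folklore] -/
theorem Function.injective_vec4 {α : Type} {a b c d : α} (hab : a ≠ b) (hac : a ≠ c) (had : a ≠ d)
    (hbc : b ≠ c) (hbd : b ≠ d) (hcd : c ≠ d) : Function.Injective ![a, b, c, d] := by
  intro i j h
  fin_cases i <;> fin_cases j
  all_goals first | rfl | (exfalso; first
    | exact hab h | exact hab h.symm | exact hac h | exact hac h.symm | exact had h | exact had h.symm
    | exact hbc h | exact hbc h.symm | exact hbd h | exact hbd h.symm | exact hcd h | exact hcd h.symm)

/-! ## The model: `P = A⟦u, v⟧`, `z = (u, v, t₀, …, t_{m-1})` -/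

section Model

variable {A : Type} [CommRing A] [IsRegularLocalRing A] {m : ℕ} (t : Fin m → A)
  (ht : Ideal.span (Set.range t) = maximalIdeal A) (hdim : ringKrullDim A = m)

include ht in
/-- `(u, v, t₀, …, t_{m-1})` generates the maximal ideal of `A⟦u, v⟧`. [cite: Matsumura1987, Thm. 15.4] -/
theorem span_range_modelRsop :
    Ideal.span (Set.range (Fin.append (fun i : Fin 2 => (MvPowerSeries.X i : MvPowerSeries (Fin 2) A))
      (fun i : Fin m => MvPowerSeries.C (t i)))) = maximalIdeal (MvPowerSeries (Fin 2) A) := by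
  rw [Set.range_fin_append, Ideal.span_union, maximalIdeal_mvPowerSeries_eq A 2, sup_comm, ← ht, Ideal.map_span,
    ← Set.range_comp]
  rfl

include ht hdim in
/-- `dim A⟦u, v⟧ = m + 2`. [cite: Matsumura1987, Thm. 15.4] -/
theorem ringKrullDim_model : ringKrullDim (MvPowerSeries (Fin 2) A) = (2 + m : ℕ) := by
  haveI := isRegularLocalRing_mvPowerSeries_of_isRegularLocalRing A 2
  apply le_antisymm
  · rw [← IsRegularLocalRing.spanFinrank_maximalIdeal, ← span_range_modelRsop t ht]
    have h1 := Submodule.spanFinrank_span_le_ncard_of_finite (R := MvPowerSeries (Fin 2) A)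
      (M := MvPowerSeries (Fin 2) A) (Set.finite_range (Fin.append
        (fun i : Fin 2 => (MvPowerSeries.X i : MvPowerSeries (Fin 2) A)) (fun i : Fin m => MvPowerSeries.C (t i))))
    have h2 : (Set.range (Fin.append (fun i : Fin 2 => (MvPowerSeries.X i : MvPowerSeries (Fin 2) A))
        (fun i : Fin m => MvPowerSeries.C (t i)))).ncard ≤ 2 + m := by
      have h := Set.ncard_image_le (f := Fin.append (fun i : Fin 2 => (MvPowerSeries.X i : MvPowerSeries (Fin 2) A))
        (fun i : Fin m => MvPowerSeries.C (t i))) (s := Set.univ) Set.finite_univ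
      rwa [Set.image_univ, Set.ncard_univ, Nat.card_eq_fintype_card, Fintype.card_fin] at h
    exact_mod_cast h1.trans h2
  · have h := ringKrullDim_add_le_ringKrullDim_mvPowerSeries A 2
    rw [hdim] at h
    calc ((2 + m : ℕ) : WithBot ℕ∞) = (m : WithBot ℕ∞) + 2 := by push_cast; ring
      _ ≤ _ := h

include ht hdim in
/-- **`(u, v, t₀, …, t_{m-1})` is a regular system of parameters of `A⟦u, v⟧`** (in the sense
of `IsRsopPart`). [cite: Matsumura1987, Thm. 15.4] -/
theorem isRsopPart_model :
    haveI := isRegularLocalRing_mvPowerSeries_of_isRegularLocalRing A 2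
    IsRsopPart (Fin.append (fun i : Fin 2 => (MvPowerSeries.X i : MvPowerSeries (Fin 2) A))
      (fun i : Fin m => MvPowerSeries.C (t i))) :=
  haveI := isRegularLocalRing_mvPowerSeries_of_isRegularLocalRing A 2
  isRsopPart_of_span_eq_of_ringKrullDim_eq _ (span_range_modelRsop t ht) (ringKrullDim_model t ht hdim)

omit [IsRegularLocalRing A] in
/-- The index vector `(u, v, t_a, t_b)` of the centre is injective for `u ≠ v`, `a ≠ b`. [folklore] -/
theorem injective_modelι (u v : Fin 2) (huv : u ≠ v) (a b : Fin m) (hab : a ≠ b) :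
    Function.Injective (![Fin.castAdd m u, Fin.castAdd m v, Fin.natAdd 2 a, Fin.natAdd 2 b] : Fin 4 → Fin (2 + m)) := by
  have hne : ∀ (w : Fin 2) (c : Fin m), Fin.castAdd m w ≠ Fin.natAdd 2 c := fun w c h => by
    have := congrArg Fin.val h
    simp only [Fin.val_castAdd, Fin.val_natAdd] at this
    have := w.isLt
    omega
  refine Function.injective_vec4 (fun h => huv (Fin.castAdd_injective _ _ h)) (hne u a) (hne u b) (hne v a) (hne v b)
    (fun h => hab (Fin.natAdd_injective _ _ h))

omit [IsRegularLocalRing A] in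
/-- Membership in the range of the index vector. [folklore] -/
theorem mem_range_modelι_iff (u v : Fin 2) (a b : Fin m) (k : Fin (2 + m)) :
    k ∈ Set.range (![Fin.castAdd m u, Fin.castAdd m v, Fin.natAdd 2 a, Fin.natAdd 2 b] : Fin 4 → Fin (2 + m)) ↔
      k = Fin.castAdd m u ∨ k = Fin.castAdd m v ∨ k = Fin.natAdd 2 a ∨ k = Fin.natAdd 2 b := by
  have h := Set.range_vec4 id (Fin.castAdd m u) (Fin.castAdd m v) (Fin.natAdd 2 a) (Fin.natAdd 2 b)
  rw [Function.id_comp] at h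
  rw [h]
  simp only [id, Set.mem_insert_iff, Set.mem_singleton_iff]

omit [IsRegularLocalRing A] in
/-- The further branches `t_i`, `i < s`, `i ≠ a, b`, are off the centre. [folklore] -/
theorem modelS_disjoint (s : ℕ) (u v : Fin 2) (a b : Fin m) :
    ∀ k ∈ (Finset.univ.filter (fun i : Fin m => i.val < s ∧ i ≠ a ∧ i ≠ b)).image (Fin.natAdd 2),
      k ∉ Set.range (![Fin.castAdd m u, Fin.castAdd m v, Fin.natAdd 2 a, Fin.natAdd 2 b] : Fin 4 → Fin (2 + m)) := by
  intro k hk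
  obtain ⟨i, hi, rfl⟩ := Finset.mem_image.mp hk
  simp only [Finset.mem_filter, Finset.mem_univ, true_and] at hi
  rw [mem_range_modelι_iff]
  have hne : ∀ (w : Fin 2), Fin.natAdd 2 i ≠ Fin.castAdd m w := fun w h => by
    have := congrArg Fin.val h
    simp only [Fin.val_castAdd, Fin.val_natAdd] at this
    have := w.isLt
    omega
  rintro (h | h | h | h)
  · exact hne u h
  · exact hne v h
  · exact hi.2.1 (Fin.natAdd_injective _ _ h)
  · exact hi.2.2 (Fin.natAdd_injective _ _ h)

omit [IsRegularLocalRing A] in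
/-- The product of the further branches is the constant `∏_{i<s, i≠a,b} tᵢ`. [folklore] -/
theorem prod_modelS (s : ℕ) (a b : Fin m) :
    ∏ k ∈ (Finset.univ.filter (fun i : Fin m => i.val < s ∧ i ≠ a ∧ i ≠ b)).image (Fin.natAdd 2),
      Fin.append (fun i : Fin 2 => (MvPowerSeries.X i : MvPowerSeries (Fin 2) A)) (fun i : Fin m => MvPowerSeries.C (t i)) k =
      MvPowerSeries.C (∏ i ∈ Finset.univ.filter (fun i : Fin m => i.val < s ∧ i ≠ a ∧ i ≠ b), t i) := by
  rw [Finset.prod_image (fun i _ j _ h => Fin.natAdd_injective _ _ h), map_prod]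
  refine Finset.prod_congr rfl fun i _ => ?_
  exact Fin.append_right _ _ i

omit [IsRegularLocalRing A] in
/-- **The relation `uv - ∏_{i<s} tᵢ` in terms of the centre**: `F = z_u z_v - t_a t_b ∏''` with
`∏'' = ∏_{i<s, i≠a,b} tᵢ`, for `a ≠ b` below `s`. [cite: DeJong1996, 4.27, p. 76] -/
theorem nodeDeformationRelation_eq_model (s : ℕ) (u v : Fin 2) (huv : u ≠ v) (a b : Fin m) (hab : a ≠ b)
    (ha : a.val < s) (hb : b.val < s) :
    DeJong1996.nodeDeformationRelation A (∏ i ∈ Finset.univ.filter (fun i : Fin m => i.val < s), t i) =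
      Fin.append (fun i : Fin 2 => (MvPowerSeries.X i : MvPowerSeries (Fin 2) A)) (fun i : Fin m => MvPowerSeries.C (t i))
          (![Fin.castAdd m u, Fin.castAdd m v, Fin.natAdd 2 a, Fin.natAdd 2 b] 0) *
        Fin.append (fun i : Fin 2 => (MvPowerSeries.X i : MvPowerSeries (Fin 2) A)) (fun i : Fin m => MvPowerSeries.C (t i))
          (![Fin.castAdd m u, Fin.castAdd m v, Fin.natAdd 2 a, Fin.natAdd 2 b] 1) -
        Fin.append (fun i : Fin 2 => (MvPowerSeries.X i : MvPowerSeries (Fin 2) A)) (fun i : Fin m => MvPowerSeries.C (t i))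
          (![Fin.castAdd m u, Fin.castAdd m v, Fin.natAdd 2 a, Fin.natAdd 2 b] 2) *
        Fin.append (fun i : Fin 2 => (MvPowerSeries.X i : MvPowerSeries (Fin 2) A)) (fun i : Fin m => MvPowerSeries.C (t i))
          (![Fin.castAdd m u, Fin.castAdd m v, Fin.natAdd 2 a, Fin.natAdd 2 b] 3) *
        ∏ k ∈ (Finset.univ.filter (fun i : Fin m => i.val < s ∧ i ≠ a ∧ i ≠ b)).image (Fin.natAdd 2),
          Fin.append (fun i : Fin 2 => (MvPowerSeries.X i : MvPowerSeries (Fin 2) A))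
            (fun i : Fin m => MvPowerSeries.C (t i)) k := by
  rw [prod_modelS]
  simp only [Matrix.cons_val_zero, Matrix.cons_val_one, Matrix.cons_val, Fin.append_left, Fin.append_right]
  -- `∏_{i<s} tᵢ = t_a t_b ∏''`
  have hmem_a : a ∈ Finset.univ.filter (fun i : Fin m => i.val < s) := by simp [ha]
  have hmem_b : b ∈ (Finset.univ.filter (fun i : Fin m => i.val < s)).erase a := by simp [hb, hab.symm]
  have hset : ((Finset.univ.filter (fun i : Fin m => i.val < s)).erase a).erase b =
      Finset.univ.filter (fun i : Fin m => i.val < s ∧ i ≠ a ∧ i ≠ b) := by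
    ext i
    simp only [Finset.mem_erase, Finset.mem_filter, Finset.mem_univ, true_and]
    tauto
  have hprod : ∏ i ∈ Finset.univ.filter (fun i : Fin m => i.val < s), t i =
      t a * t b * ∏ i ∈ Finset.univ.filter (fun i : Fin m => i.val < s ∧ i ≠ a ∧ i ≠ b), t i := by
    rw [← Finset.mul_prod_erase _ _ hmem_a, ← Finset.mul_prod_erase _ _ hmem_b, hset, mul_assoc]
  have huv' : (MvPowerSeries.X u : MvPowerSeries (Fin 2) A) * MvPowerSeries.X v = MvPowerSeries.X 0 * MvPowerSeries.X 1 := by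
    fin_cases u <;> fin_cases v
    · exact absurd rfl huv
    · rfl
    · exact mul_comm _ _
    · exact absurd rfl huv
  rw [DeJong1996.nodeDeformationRelation, hprod, map_mul, map_mul, huv']

omit [IsRegularLocalRing A] in
/-- The range of the centre `z ∘ (u, v, t_a, t_b)`. [folklore] -/
theorem range_model_comp (u v : Fin 2) (a b : Fin m) :
    Set.range (Fin.append (fun i : Fin 2 => (MvPowerSeries.X i : MvPowerSeries (Fin 2) A)) (fun i : Fin m => MvPowerSeries.C (t i)) ∘
      ![Fin.castAdd m u, Fin.castAdd m v, Fin.natAdd 2 a, Fin.natAdd 2 b]) =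
      {MvPowerSeries.X u, MvPowerSeries.X v, MvPowerSeries.C (t a), MvPowerSeries.C (t b)} := by
  rw [Set.range_vec4]
  simp only [Fin.append_left, Fin.append_right]

omit [IsRegularLocalRing A] in
/-- **The centre ideal of the model**: `(u, v, t_a, t_b) A⟦u, v⟧` maps onto
`𝔭_{ab} = (t_a, t_b) + (u, v)` in `A⟦u, v⟧/(uv - h)`. [cite: DeJong1996, 4.27, p. 75] -/
theorem map_mk_span_model_eq (h : A) (a b : Fin m) :
    (Ideal.span {(MvPowerSeries.X 0 : MvPowerSeries (Fin 2) A), MvPowerSeries.X 1, MvPowerSeries.C (t a),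
      MvPowerSeries.C (t b)}).map (Ideal.Quotient.mk (Ideal.span {DeJong1996.nodeDeformationRelation A h})) =
      (Ideal.span {t a, t b}).map (DeJong1996.NodeDeformationRing.ofBase A h) ⊔
        Ideal.span {Ideal.Quotient.mk _ (MvPowerSeries.X 0), Ideal.Quotient.mk _ (MvPowerSeries.X 1)} := by
  rw [Ideal.map_span, Ideal.map_span, ← Ideal.span_union]
  congr 1
  ext x
  simp only [Set.image_insert_eq, Set.image_singleton, Set.mem_insert_iff, Set.mem_singleton_iff, Set.mem_union,
    DeJong1996.NodeDeformationRing.ofBase_apply]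
  tauto

omit [IsRegularLocalRing A] in
/-- The set of four generators with `u, v` swapped is the same. [folklore] -/
theorem span_model_swap (a b : Fin m) (u v : Fin 2) (huv : u ≠ v) :
    (Ideal.span {(MvPowerSeries.X u : MvPowerSeries (Fin 2) A), MvPowerSeries.X v, MvPowerSeries.C (t a),
      MvPowerSeries.C (t b)} : Ideal (MvPowerSeries (Fin 2) A)) =
      Ideal.span {(MvPowerSeries.X 0 : MvPowerSeries (Fin 2) A), MvPowerSeries.X 1, MvPowerSeries.C (t a),
        MvPowerSeries.C (t b)} := by
  fin_cases u <;> fin_cases v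
  · exact absurd rfl huv
  · rfl
  · exact congrArg Ideal.span (Set.insert_comm _ _ _)
  · exact absurd rfl huv

omit [IsRegularLocalRing A] in
/-- `𝔭_{ab} = 𝔭_{ba}`. [folklore] -/
theorem span_model_pair_comm (a b : Fin m) :
    (Ideal.span {(MvPowerSeries.X 0 : MvPowerSeries (Fin 2) A), MvPowerSeries.X 1, MvPowerSeries.C (t a),
      MvPowerSeries.C (t b)} : Ideal (MvPowerSeries (Fin 2) A)) =
      Ideal.span {(MvPowerSeries.X 0 : MvPowerSeries (Fin 2) A), MvPowerSeries.X 1, MvPowerSeries.C (t b),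
        MvPowerSeries.C (t a)} := by
  rw [Set.pair_comm]

include ht hdim in
/-- **Charts `u ≠ 0`, `v ≠ 0` of the blow-up of the model are regular over the centre**
("Clearly, this is smooth"): for the model `A⟦u, v⟧/(uv - ∏_{i<s} tᵢ)` and the centre
`𝔭_{ab} = (t_a, t_b) + (u, v)` (`a ≠ b` below `s`), the local rings of the chart
`(A⟦u,v⟧/(F))[𝔭_{ab}/w]`, `w ∈ {u, v}`, at primes containing `w` are regular.
[cite: DeJong1996, 4.27, p. 76] [cite: DeJong1997, proof of Prop. 5.11, p. 619] -/
theorem model_isRegularLocalRing_chartUV (s : ℕ) (u v : Fin 2) (huv : u ≠ v) (a b : Fin m) (hab : a ≠ b)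
    (ha : a.val < s) (hb : b.val < s)
    {J : Ideal (DeJong1996.NodeDeformationRing A (∏ i ∈ Finset.univ.filter (fun i : Fin m => i.val < s), t i))}
    (hJ : (Ideal.span {(MvPowerSeries.X 0 : MvPowerSeries (Fin 2) A), MvPowerSeries.X 1, MvPowerSeries.C (t a),
      MvPowerSeries.C (t b)}).map (Ideal.Quotient.mk _) = J)
    (𝔮 : Ideal (blowupAlgebra J (Ideal.Quotient.mk _ (MvPowerSeries.X u)))) (h𝔮p : 𝔮.IsPrime)
    (h0 : algebraMap _ _ (Ideal.Quotient.mk (Ideal.span {DeJong1996.nodeDeformationRelation A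
      (∏ i ∈ Finset.univ.filter (fun i : Fin m => i.val < s), t i)}) (MvPowerSeries.X u)) ∈ 𝔮) :
    IsRegularLocalRing (Localization.AtPrime 𝔮) := by
  haveI := h𝔮p
  haveI := isRegularLocalRing_mvPowerSeries_of_isRegularLocalRing A 2
  have hz := isRsopPart_model t ht hdim
  have hι := injective_modelι u v huv a b hab
  refine isRegularLocalRing_chartU_of_eq hz hι (nodeDeformationRelation_eq_model t s u v huv a b hab ha hb)
    (b := MvPowerSeries.X u) (Fin.append_left _ _ u) ?_ 𝔮 h0
  rw [range_model_comp, span_model_swap t a b u v huv]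
  exact hJ

end Model

/-! ## Chart `t_a ≠ 0` of the model -/

/-- **Chart `t_a ≠ 0` of the blow-up of the model: the non-regular points over the centre lie on
the strict transforms of the other `V(𝔭_{ii'})`** (de Jong 1996, 4.27 [C1], coefficient-free):
for the model `A⟦u, v⟧/(uv - ∏_{i<s} tᵢ)`, the centre `𝔭_{ab}` (`a ≠ b` below `s`) and a prime
`𝔮 ∋ t̄_a` of the chart `(A⟦u,v⟧/(F))[𝔭_{ab}/t_a]` at which the chart is not regular, `𝔮` lies
over a prime `𝔯 ∌ t̄_a` containing `𝔭_{ii'}` for some `i < i' < s` (necessarily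
`{i, i'} ≠ {a, b}`). [cite: DeJong1996, 4.27, p. 76] [cite: DeJong1997, proof of Prop. 5.11, p. 619] -/
theorem model_exists_prime_le_chartT {A : Type} [CommRing A] [IsRegularLocalRing A] {m : ℕ} (t : Fin m → A)
    (ht : Ideal.span (Set.range t) = maximalIdeal A) (hdim : ringKrullDim A = m) (s : ℕ) (a b : Fin m) (hab : a ≠ b) (ha : a.val < s) (hb : b.val < s)
    {J : Ideal (DeJong1996.NodeDeformationRing A (∏ i ∈ Finset.univ.filter (fun i : Fin m => i.val < s), t i))}
    (hJ : (Ideal.span {(MvPowerSeries.X 0 : MvPowerSeries (Fin 2) A), MvPowerSeries.X 1, MvPowerSeries.C (t a),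
      MvPowerSeries.C (t b)}).map (Ideal.Quotient.mk _) = J)
    (𝔮 : Ideal (blowupAlgebra J (Ideal.Quotient.mk _ (MvPowerSeries.C (t a))))) (h𝔮p : 𝔮.IsPrime)
    (h2 : algebraMap _ _ (Ideal.Quotient.mk (Ideal.span {DeJong1996.nodeDeformationRelation A
      (∏ i ∈ Finset.univ.filter (fun i : Fin m => i.val < s), t i)}) (MvPowerSeries.C (t a))) ∈ 𝔮)
    (h𝔮 : ¬ IsRegularLocalRing (Localization.AtPrime 𝔮)) :
    ∃ i i' : Fin m, i < i' ∧ i'.val < s ∧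
      ∃ 𝔯 : Ideal (blowupAlgebra J (Ideal.Quotient.mk _ (MvPowerSeries.C (t a)))), 𝔯.IsPrime ∧ 𝔯 ≤ 𝔮 ∧
        algebraMap _ _ (Ideal.Quotient.mk (Ideal.span {DeJong1996.nodeDeformationRelation A
          (∏ i ∈ Finset.univ.filter (fun i : Fin m => i.val < s), t i)}) (MvPowerSeries.C (t a))) ∉ 𝔯 ∧
        ((Ideal.span {t i, t i'}).map (DeJong1996.NodeDeformationRing.ofBase A
            (∏ l ∈ Finset.univ.filter (fun l : Fin m => l.val < s), t l)) ⊔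
          Ideal.span {Ideal.Quotient.mk _ (MvPowerSeries.X 0), Ideal.Quotient.mk _ (MvPowerSeries.X 1)}).map
            (algebraMap _ (blowupAlgebra J (Ideal.Quotient.mk _ (MvPowerSeries.C (t a))))) ≤ 𝔯 := by
  haveI := h𝔮p
  haveI := isRegularLocalRing_mvPowerSeries_of_isRegularLocalRing A 2
  have hz := isRsopPart_model t ht hdim
  have hι := injective_modelι 0 1 (by decide) a b hab
  have hJ' : (Ideal.span (Set.range (Fin.append (fun i : Fin 2 => (MvPowerSeries.X i : MvPowerSeries (Fin 2) A))
      (fun i : Fin m => MvPowerSeries.C (t i)) ∘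
        ![Fin.castAdd m 0, Fin.castAdd m 1, Fin.natAdd 2 a, Fin.natAdd 2 b]))).map (Ideal.Quotient.mk _) = J := by
    rw [range_model_comp]
    exact hJ
  obtain ⟨p, q, hpq, hp, hq, 𝔯, h𝔯p, h𝔯le, h𝔯a, h𝔯K⟩ := exists_prime_le_chartT_of_eq hz hι (modelS_disjoint s 0 1 a b)
    rfl (nodeDeformationRelation_eq_model t s 0 1 (by decide) a b hab ha hb) (b := MvPowerSeries.C (t a))
    (Fin.append_right _ _ a) hJ' 𝔮 h2 h𝔮
  -- read off the indices
  have hpi : ∃ i : Fin m, i.val < s ∧ p = Fin.natAdd 2 i := by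
    rcases hp with rfl | hp
    · exact ⟨b, hb, rfl⟩
    · obtain ⟨i, hi, rfl⟩ := Finset.mem_image.mp hp
      exact ⟨i, (Finset.mem_filter.mp hi).2.1, rfl⟩
  have hqi : ∃ i : Fin m, i.val < s ∧ q = Fin.natAdd 2 i := by
    obtain ⟨i, hi, rfl⟩ := Finset.mem_image.mp hq
    exact ⟨i, (Finset.mem_filter.mp hi).2.1, rfl⟩
  obtain ⟨i, his, rfl⟩ := hpi
  obtain ⟨i', hi's, rfl⟩ := hqi
  have hii' : i ≠ i' := fun h => hpq (by rw [h])
  have hK : Ideal.span {Fin.append (fun i : Fin 2 => (MvPowerSeries.X i : MvPowerSeries (Fin 2) A))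
      (fun i : Fin m => MvPowerSeries.C (t i)) (![Fin.castAdd m 0, Fin.castAdd m 1, Fin.natAdd 2 a, Fin.natAdd 2 b] 0),
      Fin.append (fun i : Fin 2 => (MvPowerSeries.X i : MvPowerSeries (Fin 2) A))
      (fun i : Fin m => MvPowerSeries.C (t i)) (![Fin.castAdd m 0, Fin.castAdd m 1, Fin.natAdd 2 a, Fin.natAdd 2 b] 1),
      Fin.append (fun i : Fin 2 => (MvPowerSeries.X i : MvPowerSeries (Fin 2) A))
      (fun i : Fin m => MvPowerSeries.C (t i)) (Fin.natAdd 2 i),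
      Fin.append (fun i : Fin 2 => (MvPowerSeries.X i : MvPowerSeries (Fin 2) A))
      (fun i : Fin m => MvPowerSeries.C (t i)) (Fin.natAdd 2 i')} =
      Ideal.span {(MvPowerSeries.X 0 : MvPowerSeries (Fin 2) A), MvPowerSeries.X 1, MvPowerSeries.C (t i),
        MvPowerSeries.C (t i')} := by
    simp only [Matrix.cons_val_zero, Matrix.cons_val_one, Fin.append_left, Fin.append_right]
  rw [hK] at h𝔯K
  rcases lt_or_gt_of_ne hii' with hlt | hlt
  · refine ⟨i, i', hlt, hi's, 𝔯, h𝔯p, h𝔯le, h𝔯a, ?_⟩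
    rw [← map_mk_span_model_eq]
    exact h𝔯K
  · refine ⟨i', i, hlt, his, 𝔯, h𝔯p, h𝔯le, h𝔯a, ?_⟩
    rw [← map_mk_span_model_eq, ← span_model_pair_comm]
    exact h𝔯K


end Summit.ResolutionOfSingularities.ResolutionOfSingularities.Theorems

end
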